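import Literature.NumberTheory.Rogawski1990.LevelOnePieceStrataConstancy      -- ★ p846483 (U): level-1 twin + its plumbing (Hensel surjectivity, `red`, `coe_localNonsplitEquiv_apply`)
import Literature.NumberTheory.Automorphic.UnitaryLevelTwoLiftPieces           -- ★ p846479: `apply_eq_of_congr_levelTwo`, `coe_localNonsplitEquiv_mul`, `mem_cmLocalIntegralLevel_iff_isIntMatrix`
import Literature.GroupTheory.SpecificGroups.FiniteUnitaryThreeNilpotentOrbits        -- ★ (this seat) FINITE HALF: `exists_unitary_conj_eq_of_pow_three_eq_zero_of_rank_eq` (nilpotent orbits by rank)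
import HarnessLib

/-!
# ORGAN (V)-INT «THREE `Ad K`-ORBITS ON `K(1)⧸K(2)` BY RANK OF THE RESIDUAL NILPOTENT»: a `K(2)`-left-invariant, `Ad K`-invariant piece `g` on `U(H′)(L⁺_v)` is
# CONSTANT on each interior level-2 stratum `{x ∈ K : x_w ≡ 1 (ϖ), rank red(ϖ⁻¹(x_w − 1)) = s}` (road «S3-tree», END fold v3.2 `stub_liftValues`, INT half)

Topic `NumberTheory/Rogawski1990`; namespace `Literature.NumberTheory.Rogawski1990`.  THEOREMS ONLY (no definition, no instance, no notation, no named fact, no `sorry`).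
Cell `pub/hodgecm-mathlib` (D-0151), crux H413 = `stmt-HodgeConjecture-24833`; road «S3-tree» (architect A-p16 (g30) A-122 ∕ A-123 (2) ∕ A-130 (1) ∕ A-134); END F0P3a-p03
fold v3.2 404672a0f667a4e7 `stub_liftValues` :347, the three INT conjuncts (`INT_s` WITHOUT deepness witness); the BD half is ★ `exists_boundaryValues_of_levelTwo`
(F0P3a-p06 (g14), `LevelTwoPieceBoundaryValues`).  Seat F0P3-p03 (g14); statement-first 55da9d10efc837ae read «=» by ref5 (g2) R-132 and A-134.

THE MATHEMATICS ([Rogawski1990, §4.9 p. 54; §3.9 p. 32, Prop. 3.9.1]; [PlatonovRapinchuk1994, §3.3]).  `v` non-split unramified in the CM field `L`, `w ∣ v`, `σ_w` the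
conjugation of `L_w` (`σ̄_w = Frob_q`, `|𝓀_w| = q²`), `K = U(H′)(𝒪_v)` hyperspecial (`J = H′_w ∈ GL₃(𝒪_w)`), `2 ∈ 𝒪_w^×`, `ϖ = ϖ_v` a `σ_w`-FIXED uniformizer.  This file is the
ADDITIVE TWIN of ★ `strataConstancy_of_levelOne` (level 1: `K ↠ U(J̄)(𝔽_q)` and unipotent classes by Jordan rank, ★ `exists_conj_eq_of_rank_sub_one_eq_of_hermitian`):
(1) for `x ∈ K` with `x_w = 1 + ϖX`, `X ∈ M₃(𝒪_w)`, unitarity `σ(x_w)ᵀ J x_w = J` read modulo `ϖ²` gives `σ(X)ᵀJ + JX ≡ 0 (ϖ)`, i.e. the residual matrix `N_x := red X`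
lies in `Lie U(σ̄_w, J̄) = {N : J̄⁻¹ σ̄(N)ᵀ J̄ = −N}` — this is the isomorphism `K(1)⧸K(2) ≅ Lie U(J̄)(𝔽_q)`, and `Ad K` acts through `K ↠ U(J̄)(𝔽_q)` (`N_{yxy⁻¹} = ȳ N_x ȳ⁻¹`);
(2) FINITE HALF (★ `FiniteUnitaryThreeNilpotentOrbits`): the nilpotent `Ad U(J̄)(𝔽_q)`-orbits in `Lie U(J̄)(𝔽_q)` are classified by the rank `0, 1, 2` — proved WITHOUT Lang's theorem by the truncated CAYLEY map
`W(N) = 1 − 2N + 2N²` (`= (1 − N)(1 + N)⁻¹` when `N³ = 0`; cf. ★ `cayley_mem_unitaryGroupOfForm`): `W(N) ∈ U(σ̄, J̄)` (`θ_J̄(W) · W = 1 + 4N⁴ = 1`), `W(N) − 1 = N · 2(N − 1)` is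
nilpotent of the SAME rank, `W` is `Ad`-equivariant and injective on cube-zero matrices (`2 ≠ 0`: `W − 1 = 2(N² − N)` and `(N² − N)² = N²`), so ★ p845492 transfers;
(3) Hensel (★ `unitary_residueHom_surjective_of_frobenius`) lifts the finite conjugator to `y ∈ K`; then `red(ϖ⁻¹((e(yxy⁻¹))_w − 1)) = ȳ N_x ȳ⁻¹ = N_{x′}`, so
`(e x′)_w − (e (yxy⁻¹))_w ∈ ϖ² M₃(𝒪_w)` and ★ `apply_eq_of_congr_levelTwo` (`hg2`) with `Ad K`-invariance gives `g x = g (yxy⁻¹) = g x′`.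

* FINITE HALF = ★ `Literature.GroupTheory.SpecificGroups.FiniteUnitaryThreeNilpotentOrbits` (`exists_unitary_conj_eq_of_pow_three_eq_zero_of_rank_eq`, this seat);
* **`apply_eq_apply_of_rank_redMat_levelTwo_eq`** (pairwise), **`interiorStrataConstancy_of_levelTwo`** (`∃ c′ : ℕ → ℂ`, general rank),
  **`interiorStrataConstancy_of_levelTwo_int`** (the END's `∃ c′, INT₀ ∧ INT₁ ∧ INT₂` VERBATIM; consumer: `obtain ⟨c', hc'⟩ := …` then `hc'.1 ∕ hc'.2.1 ∕ hc'.2.2`).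
The binders are those of ★ (U) with `hg1 ↦ hg2` (the stub's idle `μ hμ… νH νG hmH hmG hg hgK` are not taken).

HONEST LABEL: HC_CM is proved only modulo the printed citations (2 remaining named inputs hLiu418 24832, h413 24833) until rung 0 closes; this file is unconditional local
algebra and asserts nothing printed about the transfer.

## References
* [Rogawski1990] J. D. Rogawski, *Automorphic Representations of Unitary Groups in Three Variables*, Ann. of Math. Stud. 123 (1990): §4.9 p. 54; §3.9 p. 32, Prop. 3.9.1.
* [PlatonovRapinchuk1994] V. Platonov, A. Rapinchuk, *Algebraic Groups and Number Theory* (1994): §3.3 (reduction, Hensel, congruence filtration `G_𝒪(𝔭^j)`), §2.3.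
* [Weyl1939] H. Weyl, *The Classical Groups* (1939): Ch. II §10 (Cayley parametrisation of the unitary group by its infinitesimal elements).
-/

set_option autoImplicit false

noncomputable section

open NumberField IsDedekindDomain Matrix ValuativeRel
open Literature.NumberTheory.Automorphic Literature.NumberTheory.GaloisRepresentations Literature.NumberTheory.Automorphic.UnitaryGroup
open Literature.NumberTheory.Automorphic.IntegralReduction Literature.GroupTheory.SpecificGroups Literature.NumberTheory.Automorphic.UnitaryLatticeTree
open Literature.LinearAlgebra.Matrix
open scoped Matrix MatrixGroups ValuativeRel

namespace Literature.NumberTheory.Rogawski1990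

/-! ## THE ORGAN at the CM place: `K(1)⧸K(2) → Lie U(σ̄_w, J̄)`, Hensel lift of the finite conjugator, congruence `mod ϖ²` -/

section OrganVInt

set_option maxHeartbeats 800000 in
-- budget only: one statement-heavy declaration (the CM-place tokens of the END's stub); no search tactic runs long here.
/-- **(V)-INT, pairwise form: a `K(2)`-left-invariant `Ad K`-invariant piece takes EQUAL values at interior level-2 points `x, x′ ∈ K` (`x_w, x′_w ≡ 1 (ϖ)`) whose
residual nilpotents `red(ϖ⁻¹(x_w − 1))`, `red(ϖ⁻¹(x′_w − 1))` (cube `0`) have EQUAL rank.** [cite: Rogawski1990, §4.9 p. 54; §3.9 p. 32, Prop. 3.9.1]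
[cite: PlatonovRapinchuk1994, §3.3] [cite: Weyl1939, Ch. II §10] -/
theorem apply_eq_apply_of_rank_redMat_levelTwo_eq
    (L : Type) [Field L] [NumberField L] [IsCMField L] (H' : Matrix (Fin 3) (Fin 3) L)
    {v : HeightOneSpectrum (𝓞 ↥(maximalRealSubfield L))}
    (hH' : (H'.map (cmConjRingHom L)).transpose = H') (w : PlacesOver L v)
    (hw : IsCMField.complexConj L • w.1 = w.1) (hv : Algebra.IsUnramifiedIn (𝓞 L) v.asIdeal)
    (hH'w : IsUnit (placeForm H' w.1)) (hH'i : hH'w.unit ∈ glInt 3 (w.1.adicCompletion L))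
    (h2 : IsUnit (2 : 𝒪[(w.1.adicCompletion L)]))
    (g : ((cmDatum L 3 H').Local v) → ℂ)
    (hginv : ∀ u ∈ (cmLocalIntegralLevel L 3 H' v), ∀ x, g (u * x * u⁻¹) = g x)
    (hg2 : ∀ u : ((cmDatum L 3 H').Local v),
      (∀ a b, Valued.v (((toPlace v w (HeckeCharacter.uniformizer ↥(maximalRealSubfield L) v : v.adicCompletion ↥(maximalRealSubfield L))) ^ 2)⁻¹ *
        ((((localNonsplitEquiv (IsCMField.complexConj L) H' (IsCMField.complexConj_ne_one L) w hw u :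
            ↥(unitaryGroupOfForm (galAdicCompletionMap (L := L) (IsCMField.complexConj L) hw) (placeForm H' w.1))) : GL (Fin 3) (w.1.adicCompletion L)) :
              Matrix (Fin 3) (Fin 3) (w.1.adicCompletion L)) a b - (1 : Matrix (Fin 3) (Fin 3) (w.1.adicCompletion L)) a b)) ≤ 1) →
      ∀ x, g (u * x) = g x)
    {x x' : ((cmDatum L 3 H').Local v)} (hx : x ∈ (cmLocalIntegralLevel L 3 H' v)) (hx' : x' ∈ (cmLocalIntegralLevel L 3 H' v))
    (hx1 : ∀ a b, Valued.v (((toPlace v w (HeckeCharacter.uniformizer ↥(maximalRealSubfield L) v : v.adicCompletion ↥(maximalRealSubfield L))) ^ 1)⁻¹ *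
        ((((localNonsplitEquiv (IsCMField.complexConj L) H' (IsCMField.complexConj_ne_one L) w hw (x) :
            ↥(unitaryGroupOfForm (galAdicCompletionMap (L := L) (IsCMField.complexConj L) hw) (placeForm H' w.1))) : GL (Fin 3) (w.1.adicCompletion L)) :
              Matrix (Fin 3) (Fin 3) (w.1.adicCompletion L)) a b - (1 : Matrix (Fin 3) (Fin 3) (w.1.adicCompletion L)) a b)) ≤ 1)
    (hx'1 : ∀ a b, Valued.v (((toPlace v w (HeckeCharacter.uniformizer ↥(maximalRealSubfield L) v : v.adicCompletion ↥(maximalRealSubfield L))) ^ 1)⁻¹ *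
        ((((localNonsplitEquiv (IsCMField.complexConj L) H' (IsCMField.complexConj_ne_one L) w hw (x') :
            ↥(unitaryGroupOfForm (galAdicCompletionMap (L := L) (IsCMField.complexConj L) hw) (placeForm H' w.1))) : GL (Fin 3) (w.1.adicCompletion L)) :
              Matrix (Fin 3) (Fin 3) (w.1.adicCompletion L)) a b - (1 : Matrix (Fin 3) (Fin 3) (w.1.adicCompletion L)) a b)) ≤ 1)
    (hnil : (redMat ((toPlace v w (HeckeCharacter.uniformizer ↥(maximalRealSubfield L) v : v.adicCompletion ↥(maximalRealSubfield L)))⁻¹ • ((((x).val : GL (Fin 3) (UnitaryGroup.LocalRing L v)).val.map (Pi.evalRingHom (fun w' : PlacesOver L v => w'.1.adicCompletion L) w)) - 1))) ^ 3 = 0)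
    (hnil' : (redMat ((toPlace v w (HeckeCharacter.uniformizer ↥(maximalRealSubfield L) v : v.adicCompletion ↥(maximalRealSubfield L)))⁻¹ • ((((x').val : GL (Fin 3) (UnitaryGroup.LocalRing L v)).val.map (Pi.evalRingHom (fun w' : PlacesOver L v => w'.1.adicCompletion L) w)) - 1))) ^ 3 = 0)
    (hrank : (redMat ((toPlace v w (HeckeCharacter.uniformizer ↥(maximalRealSubfield L) v : v.adicCompletion ↥(maximalRealSubfield L)))⁻¹ • ((((x).val : GL (Fin 3) (UnitaryGroup.LocalRing L v)).val.map (Pi.evalRingHom (fun w' : PlacesOver L v => w'.1.adicCompletion L) w)) - 1))).rank =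
      (redMat ((toPlace v w (HeckeCharacter.uniformizer ↥(maximalRealSubfield L) v : v.adicCompletion ↥(maximalRealSubfield L)))⁻¹ • ((((x').val : GL (Fin 3) (UnitaryGroup.LocalRing L v)).val.map (Pi.evalRingHom (fun w' : PlacesOver L v => w'.1.adicCompletion L) w)) - 1))).rank) :
    g x = g x' := by
  classical
  -- name the `σ_w`-fixed uniformizer `ϖ` of `L⁺_v` (read in `L_w`) once, while the context is small
  set ϖ : (w.1.adicCompletion L) := (toPlace v w (HeckeCharacter.uniformizer ↥(maximalRealSubfield L) v : v.adicCompletion ↥(maximalRealSubfield L))) with hϖdef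
  have hc1 : IsCMField.complexConj L ≠ 1 := IsCMField.complexConj_ne_one L
  -- §0 the place `w` (as in ★ (U)): involution `σ_w`, its integral ∕ residual avatars, Frobenius, `|𝓀_w| = q²`, the `σ`-fixed uniformizer `ϖ`
  have hσO : ∀ x : 𝒪[(w.1.adicCompletion L)], (galAdicCompletionMap (L := L) (IsCMField.complexConj L) hw) x ∈ 𝒪[(w.1.adicCompletion L)] := mem_integer_galAdicCompletionMap (IsCMField.complexConj L) v w hw
  have hσσ : ∀ x, (galAdicCompletionMap (L := L) (IsCMField.complexConj L) hw) ((galAdicCompletionMap (L := L) (IsCMField.complexConj L) hw) x) = x := fun x => galAdicCompletionMap_galAdicCompletionMap_of_smul_eq (IsCMField.complexConj L) w hc1 hw x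
  obtain ⟨σk, hσk⟩ := exists_residueField_ringHom_galAdicCompletionMap (IsCMField.complexConj L) v w hw
  have hq : Nat.card 𝓀[(w.1.adicCompletion L)] = Nat.card (𝓞 ↥(maximalRealSubfield L) ⧸ v.asIdeal) ^ 2 := natCard_residueField_eq_sq_of_inert (IsCMField.complexConj L) v hc1 hv w hw
  have hσq : ∀ y : 𝓀[(w.1.adicCompletion L)], σk y = y ^ Nat.card (𝓞 ↥(maximalRealSubfield L) ⧸ v.asIdeal) :=
    residueHom_galAdicCompletionMap_eq_pow (IsCMField.complexConj L) v hc1 hv w hw σk hσO hσk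
  letI : Fintype 𝓀[(w.1.adicCompletion L)] := Fintype.ofFinite _
  have hq' : Fintype.card 𝓀[(w.1.adicCompletion L)] = Nat.card (𝓞 ↥(maximalRealSubfield L) ⧸ v.asIdeal) ^ 2 := by rw [← Nat.card_eq_fintype_card, hq]
  have hϖv : Valued.v ϖ = WithZero.exp (-1 : ℤ) := Liu2021.LemD1IndexedNonVacuityInertCofinite.valued_toPlace_uniformizer_of_isUnramifiedIn L v hv w
  have hϖ : IsUniformizingElement ϖ := isUniformizingElement_of_v_eq hϖv
  have hσϖ : (galAdicCompletionMap (L := L) (IsCMField.complexConj L) hw) ϖ = ϖ := galAdicCompletionMap_toPlace (IsCMField.complexConj L) w w hw _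
  have h2k : (2 : 𝓀[(w.1.adicCompletion L)]) ≠ 0 := by
    have h := h2.map (IsLocalRing.residue 𝒪[(w.1.adicCompletion L)])
    rw [map_ofNat] at h
    exact h.ne_zero
  -- §1 the form `J = H′_w` and its integral model `J_𝒪` (unimodular, `σ_w`-hermitian)
  have hJint : ∀ i j, (placeForm H' w.1) i j ∈ 𝒪[(w.1.adicCompletion L)] := fun i j => ((mem_glInt_iff _).1 hH'i).1 i j
  have hJinv : ∀ i j, (((hH'w.unit⁻¹ : (Matrix (Fin 3) (Fin 3) (w.1.adicCompletion L))ˣ) : Matrix (Fin 3) (Fin 3) (w.1.adicCompletion L))) i j ∈ 𝒪[(w.1.adicCompletion L)] :=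
    fun i j => ((mem_glInt_iff _).1 hH'i).2 i j
  let JO : Matrix (Fin 3) (Fin 3) 𝒪[(w.1.adicCompletion L)] := Matrix.of fun i j => ⟨(placeForm H' w.1) i j, hJint i j⟩
  have hJ : (placeForm H' w.1) = JO.map ((↑) : 𝒪[(w.1.adicCompletion L)] → (w.1.adicCompletion L)) := by ext i j; rfl
  have hinjO : Function.Injective (fun M : Matrix (Fin 3) (Fin 3) 𝒪[(w.1.adicCompletion L)] => M.map ((↑) : 𝒪[(w.1.adicCompletion L)] → (w.1.adicCompletion L))) :=
    Matrix.map_injective Subtype.val_injective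
  have hJOdet : IsUnit JO.det := by
    let JI : Matrix (Fin 3) (Fin 3) 𝒪[(w.1.adicCompletion L)] :=
      Matrix.of fun i j => ⟨(((hH'w.unit⁻¹ : (Matrix (Fin 3) (Fin 3) (w.1.adicCompletion L))ˣ) : Matrix (Fin 3) (Fin 3) (w.1.adicCompletion L))) i j, hJinv i j⟩
    have hJI : (((hH'w.unit⁻¹ : (Matrix (Fin 3) (Fin 3) (w.1.adicCompletion L))ˣ) : Matrix (Fin 3) (Fin 3) (w.1.adicCompletion L))) = JI.map ((↑) : 𝒪[(w.1.adicCompletion L)] → (w.1.adicCompletion L)) := by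
      ext i j; rfl
    have hmul : JO * JI = 1 := by
      apply hinjO
      change (JO * JI).map ⇑(𝒪[(w.1.adicCompletion L)]).subtype = (1 : Matrix (Fin 3) (Fin 3) 𝒪[(w.1.adicCompletion L)]).map ⇑(𝒪[(w.1.adicCompletion L)]).subtype
      rw [Matrix.map_mul, Matrix.map_one (𝒪[(w.1.adicCompletion L)]).subtype (map_zero _) (map_one _)]
      change JO.map ((↑) : 𝒪[(w.1.adicCompletion L)] → (w.1.adicCompletion L)) * JI.map ((↑) : 𝒪[(w.1.adicCompletion L)] → (w.1.adicCompletion L)) = 1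
      rw [← hJ, ← hJI]
      have hmi := hH'w.unit.mul_inv
      rw [hH'w.unit_spec] at hmi
      exact hmi
    exact Matrix.isUnit_det_of_right_inverse hmul
  have hJσ : ((placeForm H' w.1).map (galAdicCompletionMap (L := L) (IsCMField.complexConj L) hw))ᵀ = (placeForm H' w.1) := placeForm_hermitian_of_smul_eq (c := IsCMField.complexConj L) w H' hH' hw
  clear_value JO
  -- §2 reduction `red : K_w → U(σ̄_w, J̄)(𝓀_w)` (★ D-T1u) and its SURJECTIVITY (★ Hensel)
  obtain ⟨red, hred⟩ := exists_unitary_residueHom (galAdicCompletionMap (L := L) (IsCMField.complexConj L) hw) (placeForm H' w.1) JO hJ σk hσO hσk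
  have hsurj : Function.Surjective red :=
    unitary_residueHom_surjective_of_frobenius (galAdicCompletionMap (L := L) (IsCMField.complexConj L) hw) (placeForm H' w.1) hσσ hσO σk hσk hq hσq JO hJ hJσ hJOdet
      ⟨_, hϖ.mem⟩ hϖ.span_eq hσϖ red hred
  -- the residual form `J̄ = J_𝒪 mod 𝓂` is `σ̄`-hermitian and non-degenerate, and is `redMat J`
  let τ : 𝒪[(w.1.adicCompletion L)] → 𝒪[(w.1.adicCompletion L)] := fun x => ⟨(galAdicCompletionMap (L := L) (IsCMField.complexConj L) hw) x, hσO x⟩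
  have hJOτ : (JO.map τ)ᵀ = JO := by
    apply hinjO
    change ((JO.map τ)ᵀ).map ((↑) : 𝒪[(w.1.adicCompletion L)] → (w.1.adicCompletion L)) = JO.map ((↑) : 𝒪[(w.1.adicCompletion L)] → (w.1.adicCompletion L))
    rw [Matrix.transpose_map]
    have hmm : (JO.map τ).map ((↑) : 𝒪[(w.1.adicCompletion L)] → (w.1.adicCompletion L)) = (JO.map ((↑) : 𝒪[(w.1.adicCompletion L)] → (w.1.adicCompletion L))).map (galAdicCompletionMap (L := L) (IsCMField.complexConj L) hw) := by ext i j; rfl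
    rw [hmm, ← hJ]
    exact hJσ
  have hJk : ((JO.map (IsLocalRing.residue 𝒪[(w.1.adicCompletion L)])).map σk)ᵀ = JO.map (IsLocalRing.residue 𝒪[(w.1.adicCompletion L)]) := by
    have h := congrArg (fun M : Matrix (Fin 3) (Fin 3) 𝒪[(w.1.adicCompletion L)] => M.map (IsLocalRing.residue 𝒪[(w.1.adicCompletion L)])) hJOτ
    simp only [Matrix.transpose_map, Matrix.map_map] at h
    have hcomp : (⇑(IsLocalRing.residue 𝒪[(w.1.adicCompletion L)]) ∘ τ) = (⇑σk ∘ ⇑(IsLocalRing.residue 𝒪[(w.1.adicCompletion L)])) := funext fun x => hσk x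
    rw [hcomp, ← Matrix.map_map] at h
    exact h
  have hJkdet : (JO.map (IsLocalRing.residue 𝒪[(w.1.adicCompletion L)])).det ≠ 0 := by
    rw [← RingHom.mapMatrix_apply, ← RingHom.map_det]
    exact (hJOdet.map _).ne_zero
  have hredJ : redMat (placeForm H' w.1) = JO.map (IsLocalRing.residue 𝒪[(w.1.adicCompletion L)]) := by
    rw [hJ]; ext i j; exact red_coe _
  have hJv : ValBound 1 (placeForm H' w.1) := fun i j => (Valuation.mem_integer_iff _ _).1 (hJint i j)
  -- §3 `K` inside the domain `U(J)(𝒪_w)` of `red`; the reduction read on it (entries = residues = `redMat`)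
  have hKI : ∀ {z : ((cmDatum L 3 H').Local v)}, z ∈ (cmLocalIntegralLevel L 3 H' v) → (((localNonsplitEquiv (IsCMField.complexConj L) H' (IsCMField.complexConj_ne_one L) w hw z) : ↥(unitaryGroupOfForm (galAdicCompletionMap (L := L) (IsCMField.complexConj L) hw) (placeForm H' w.1))) : GL (Fin 3) (w.1.adicCompletion L)) ∈ glInt 3 (w.1.adicCompletion L) := fun {z} hz =>
    (mem_localIntegralLevel_iff_of_smul_eq (IsCMField.complexConj L) 3 H' hc1 w hw z).1 hz
  have hredK : ∀ z : ↥((glInt 3 (w.1.adicCompletion L)).subgroupOf (unitaryGroupOfForm (galAdicCompletionMap (L := L) (IsCMField.complexConj L) hw) (placeForm H' w.1))), (((red z : ↥(unitaryGroupOfForm σk (JO.map (IsLocalRing.residue 𝒪[(w.1.adicCompletion L)])))) : GL (Fin 3) 𝓀[(w.1.adicCompletion L)]) : Matrix (Fin 3) (Fin 3) 𝓀[(w.1.adicCompletion L)]) = redMat ((((z : ↥((glInt 3 (w.1.adicCompletion L)).subgroupOf (unitaryGroupOfForm (galAdicCompletionMap (L := L) (IsCMField.complexConj L) hw) (placeForm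 H' w.1)))) : ↥(unitaryGroupOfForm (galAdicCompletionMap (L := L) (IsCMField.complexConj L) hw) (placeForm H' w.1))) : GL (Fin 3) (w.1.adicCompletion L)) : Matrix (Fin 3) (Fin 3) (w.1.adicCompletion L)) := by
    intro z
    ext i j
    rw [hred]
    exact (red_coe _).symm
  -- §4 the uniformizer `ϖ` and the matrices `M = (e x)_w = 1 + ϖX`, `M′ = (e x′)_w = 1 + ϖX′`
  have hϖ0 : ϖ ≠ 0 := hϖ.ne_zero
  have hvϖ1 : valuation (w.1.adicCompletion L) ϖ < 1 := hϖ.valuation_lt_one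
  have hlt : ∀ z : (w.1.adicCompletion L), valuation (w.1.adicCompletion L) z < 1 → valuation (w.1.adicCompletion L) z ≤ valuation (w.1.adicCompletion L) ϖ := fun z hz => by
    obtain ⟨y, hy, rfl⟩ := hϖ.exists_eq_mul ((Valuation.mem_integer_iff _ _).2 hz.le) hz
    rw [map_mul]
    exact mul_le_of_le_one_right' ((Valuation.mem_integer_iff _ _).1 hy)
  have vmul : ∀ {A B : Matrix (Fin 3) (Fin 3) (w.1.adicCompletion L)}, ValBound 1 A → ValBound 1 B → ValBound 1 (A * B) := fun hA hB => by
    simpa only [one_mul] using hA.mul hB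
  obtain ⟨xk, hxk⟩ : ∃ z : ↥((glInt 3 (w.1.adicCompletion L)).subgroupOf (unitaryGroupOfForm (galAdicCompletionMap (L := L) (IsCMField.complexConj L) hw) (placeForm H' w.1))), (z : ↥(unitaryGroupOfForm (galAdicCompletionMap (L := L) (IsCMField.complexConj L) hw) (placeForm H' w.1))) = (localNonsplitEquiv (IsCMField.complexConj L) H' (IsCMField.complexConj_ne_one L) w hw x) := ⟨⟨(localNonsplitEquiv (IsCMField.complexConj L) H' (IsCMField.complexConj_ne_one L) w hw x), hKI hx⟩, rfl⟩
  obtain ⟨xk', hxk'⟩ : ∃ z : ↥((glInt 3 (w.1.adicCompletion L)).subgroupOf (unitaryGroupOfForm (galAdicCompletionMap (L := L) (IsCMField.complexConj L) hw) (placeForm H' w.1))), (z : ↥(unitaryGroupOfForm (galAdicCompletionMap (L := L) (IsCMField.complexConj L) hw) (placeForm H' w.1))) = (localNonsplitEquiv (IsCMField.complexConj L) H' (IsCMField.complexConj_ne_one L) w hw x') := ⟨⟨(localNonsplitEquiv (IsCMField.complexConj L) H' (IsCMField.complexConj_ne_one L) w hw x'), hKI hx'⟩, rfl⟩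
  obtain ⟨M, hMdef⟩ : ∃ M : Matrix (Fin 3) (Fin 3) (w.1.adicCompletion L), M = ((((xk : ↥((glInt 3 (w.1.adicCompletion L)).subgroupOf (unitaryGroupOfForm (galAdicCompletionMap (L := L) (IsCMField.complexConj L) hw) (placeForm H' w.1)))) : ↥(unitaryGroupOfForm (galAdicCompletionMap (L := L) (IsCMField.complexConj L) hw) (placeForm H' w.1))) : GL (Fin 3) (w.1.adicCompletion L)) : Matrix (Fin 3) (Fin 3) (w.1.adicCompletion L)) := ⟨_, rfl⟩
  obtain ⟨M', hM'def⟩ : ∃ M' : Matrix (Fin 3) (Fin 3) (w.1.adicCompletion L), M' = ((((xk' : ↥((glInt 3 (w.1.adicCompletion L)).subgroupOf (unitaryGroupOfForm (galAdicCompletionMap (L := L) (IsCMField.complexConj L) hw) (placeForm H' w.1)))) : ↥(unitaryGroupOfForm (galAdicCompletionMap (L := L) (IsCMField.complexConj L) hw) (placeForm H' w.1))) : GL (Fin 3) (w.1.adicCompletion L)) : Matrix (Fin 3) (Fin 3) (w.1.adicCompletion L)) := ⟨_, rfl⟩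
  have hMe : ((((localNonsplitEquiv (IsCMField.complexConj L) H' (IsCMField.complexConj_ne_one L) w hw x) : ↥(unitaryGroupOfForm (galAdicCompletionMap (L := L) (IsCMField.complexConj L) hw) (placeForm H' w.1))) : GL (Fin 3) (w.1.adicCompletion L)) : Matrix (Fin 3) (Fin 3) (w.1.adicCompletion L)) = M := by
    rw [hMdef, hxk]
  have hMe' : ((((localNonsplitEquiv (IsCMField.complexConj L) H' (IsCMField.complexConj_ne_one L) w hw x') : ↥(unitaryGroupOfForm (galAdicCompletionMap (L := L) (IsCMField.complexConj L) hw) (placeForm H' w.1))) : GL (Fin 3) (w.1.adicCompletion L)) : Matrix (Fin 3) (Fin 3) (w.1.adicCompletion L)) = M' := by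
    rw [hM'def, hxk']
  have hMx : (((x).val : GL (Fin 3) (UnitaryGroup.LocalRing L v)).val.map (Pi.evalRingHom (fun w' : PlacesOver L v => w'.1.adicCompletion L) w)) = M := by
    rw [← hMe]; exact (coe_localNonsplitEquiv_apply L H' v w hw x).symm
  have hMx' : (((x').val : GL (Fin 3) (UnitaryGroup.LocalRing L v)).val.map (Pi.evalRingHom (fun w' : PlacesOver L v => w'.1.adicCompletion L) w)) = M' := by
    rw [← hMe']; exact (coe_localNonsplitEquiv_apply L H' v w hw x').symm
  rw [hMx] at hnil hrank
  rw [hMx'] at hnil' hrank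
  rw [hMe] at hx1
  rw [hMe'] at hx'1
  obtain ⟨X, hXdef⟩ : ∃ X : Matrix (Fin 3) (Fin 3) (w.1.adicCompletion L), X = ϖ⁻¹ • (M - 1) := ⟨_, rfl⟩
  obtain ⟨X', hX'def⟩ : ∃ X' : Matrix (Fin 3) (Fin 3) (w.1.adicCompletion L), X' = ϖ⁻¹ • (M' - 1) := ⟨_, rfl⟩
  rw [← hXdef] at hnil hrank
  rw [← hX'def] at hnil' hrank
  have hM1 : M = 1 + ϖ • X := by rw [hXdef, smul_inv_smul₀ hϖ0, add_sub_cancel]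
  have hM'1 : M' = 1 + ϖ • X' := by rw [hX'def, smul_inv_smul₀ hϖ0, add_sub_cancel]
  -- integrality: `X, X′` (the stub's `^ 1` tokens), `M, M′, Y, Y⁻¹` (membership in `K`)
  have hXv : ValBound 1 X := fun a b => by
    have h := hx1 a b
    rw [pow_one] at h
    rw [hXdef, Matrix.smul_apply, Matrix.sub_apply, smul_eq_mul]
    exact (SemiLocal.valuation_le_one_iff_valued_le_one _).2 h
  have hX'v : ValBound 1 X' := fun a b => by
    have h := hx'1 a b
    rw [pow_one] at h
    rw [hX'def, Matrix.smul_apply, Matrix.sub_apply, smul_eq_mul]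
    exact (SemiLocal.valuation_le_one_iff_valued_le_one _).2 h
  have hglv : ∀ z : ↥((glInt 3 (w.1.adicCompletion L)).subgroupOf (unitaryGroupOfForm (galAdicCompletionMap (L := L) (IsCMField.complexConj L) hw) (placeForm H' w.1))),
      ValBound 1 ((((z : ↥((glInt 3 (w.1.adicCompletion L)).subgroupOf (unitaryGroupOfForm (galAdicCompletionMap (L := L) (IsCMField.complexConj L) hw) (placeForm H' w.1)))) : ↥(unitaryGroupOfForm (galAdicCompletionMap (L := L) (IsCMField.complexConj L) hw) (placeForm H' w.1))) : GL (Fin 3) (w.1.adicCompletion L)) : Matrix (Fin 3) (Fin 3) (w.1.adicCompletion L)) ∧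
      ValBound 1 (((((z : ↥((glInt 3 (w.1.adicCompletion L)).subgroupOf (unitaryGroupOfForm (galAdicCompletionMap (L := L) (IsCMField.complexConj L) hw) (placeForm H' w.1)))) : ↥(unitaryGroupOfForm (galAdicCompletionMap (L := L) (IsCMField.complexConj L) hw) (placeForm H' w.1))) : GL (Fin 3) (w.1.adicCompletion L))⁻¹ : GL (Fin 3) (w.1.adicCompletion L)) : Matrix (Fin 3) (Fin 3) (w.1.adicCompletion L)) := fun z =>
    ⟨fun i j => (Valuation.mem_integer_iff _ _).1 (((mem_glInt_iff _).1 z.2).1 i j), fun i j => (Valuation.mem_integer_iff _ _).1 (((mem_glInt_iff _).1 z.2).2 i j)⟩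
  have hMv : ValBound 1 M := by rw [hMdef]; exact (hglv xk).1
  -- §5 `N = red X` lies in `Lie U(σ̄_w, J̄)`: unitarity of `M = 1 + ϖX` read modulo `ϖ²`
  have hLie : ∀ {P Q : Matrix (Fin 3) (Fin 3) (w.1.adicCompletion L)}, ValBound 1 Q → P = 1 + ϖ • Q →
      ((P.map (galAdicCompletionMap (L := L) (IsCMField.complexConj L) hw))ᵀ * (placeForm H' w.1) * P = (placeForm H' w.1)) →
      (JO.map (IsLocalRing.residue 𝒪[(w.1.adicCompletion L)]))⁻¹ * ((redMat Q).map σk)ᵀ * (JO.map (IsLocalRing.residue 𝒪[(w.1.adicCompletion L)])) = -redMat Q := by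
    intro P Q hQv hP hU
    -- `σ_w`-conjugate of `Q` and its integrality
    have hQsv : ValBound 1 (Q.map (galAdicCompletionMap (L := L) (IsCMField.complexConj L) hw))ᵀ := fun i j => by
      rw [Matrix.transpose_apply, Matrix.map_apply]
      exact (Valuation.mem_integer_iff _ _).1 (hσO ⟨Q j i, (Valuation.mem_integer_iff _ _).2 (hQv j i)⟩)
    have hPσ : (P.map (galAdicCompletionMap (L := L) (IsCMField.complexConj L) hw))ᵀ = 1 + ϖ • (Q.map (galAdicCompletionMap (L := L) (IsCMField.complexConj L) hw))ᵀ := by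
      rw [hP, ← RingHom.mapMatrix_apply, map_add, map_one, RingHom.mapMatrix_apply,
        Matrix.map_smul _ ϖ (fun a => by rw [smul_eq_mul, smul_eq_mul, map_mul, hσϖ]), Matrix.transpose_add, Matrix.transpose_one, Matrix.transpose_smul]
    rw [hPσ, hP] at hU
    have hexp : (1 + ϖ • (Q.map (galAdicCompletionMap (L := L) (IsCMField.complexConj L) hw))ᵀ) * (placeForm H' w.1) * (1 + ϖ • Q) =
        (placeForm H' w.1) + ϖ • ((Q.map (galAdicCompletionMap (L := L) (IsCMField.complexConj L) hw))ᵀ * (placeForm H' w.1) + (placeForm H' w.1) * Q +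
          ϖ • ((Q.map (galAdicCompletionMap (L := L) (IsCMField.complexConj L) hw))ᵀ * (placeForm H' w.1) * Q)) := by
      simp only [add_mul, mul_add, Matrix.smul_mul, Matrix.mul_smul, one_mul, mul_one, smul_add, smul_smul]
      abel
    rw [hexp, add_eq_left, smul_eq_zero, or_iff_right hϖ0] at hU
    -- `hU : Qσᵀ J + J Q + ϖ • (Qσᵀ J Q) = 0`; reduce modulo `𝓂`
    have hsum : (Q.map (galAdicCompletionMap (L := L) (IsCMField.complexConj L) hw))ᵀ * (placeForm H' w.1) + (placeForm H' w.1) * Q =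
        -(ϖ • ((Q.map (galAdicCompletionMap (L := L) (IsCMField.complexConj L) hw))ᵀ * (placeForm H' w.1) * Q)) := eq_neg_of_add_eq_zero_left hU
    have hϖPv : ValBound 1 (-(ϖ • ((Q.map (galAdicCompletionMap (L := L) (IsCMField.complexConj L) hw))ᵀ * (placeForm H' w.1) * Q))) ∧
        redMat (-(ϖ • ((Q.map (galAdicCompletionMap (L := L) (IsCMField.complexConj L) hw))ᵀ * (placeForm H' w.1) * Q))) = 0 := by
      have hTv : ValBound 1 ((Q.map (galAdicCompletionMap (L := L) (IsCMField.complexConj L) hw))ᵀ * (placeForm H' w.1) * Q) := vmul (vmul hQsv hJv) hQv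
      have hlt1 : ∀ i j, valuation (w.1.adicCompletion L) ((-(ϖ • ((Q.map (galAdicCompletionMap (L := L) (IsCMField.complexConj L) hw))ᵀ * (placeForm H' w.1) * Q))) i j) < 1 := fun i j => by
        rw [Matrix.neg_apply, Matrix.smul_apply, smul_eq_mul, Valuation.map_neg, map_mul]
        exact (mul_le_of_le_one_right' (hTv i j)).trans_lt hvϖ1
      have hv1 : ValBound 1 (-(ϖ • ((Q.map (galAdicCompletionMap (L := L) (IsCMField.complexConj L) hw))ᵀ * (placeForm H' w.1) * Q))) := fun i j => (hlt1 i j).le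
      exact ⟨hv1, (redMat_eq_zero_iff_forall_valuation_lt_one hv1).2 hlt1⟩
    have hredsum := congrArg redMat hsum
    rw [hϖPv.2, redMat_add (vmul hQsv hJv) (vmul hJv hQv), redMat_mul hQsv hJv, redMat_mul hJv hQv, hredJ] at hredsum
    -- `redMat (Qσᵀ) = (redMat Q)σ̄ᵀ`
    have hredQs : redMat (Q.map (galAdicCompletionMap (L := L) (IsCMField.complexConj L) hw))ᵀ = ((redMat Q).map σk)ᵀ := by
      ext i j
      simp only [redMat, Matrix.map_apply, Matrix.transpose_apply]
      have hQO : Q j i ∈ 𝒪[(w.1.adicCompletion L)] := (Valuation.mem_integer_iff _ _).2 (hQv j i)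
      rw [show IntegralReduction.red (Q j i) = _ from red_coe ⟨Q j i, hQO⟩, ← hσk,
        show IntegralReduction.red ((galAdicCompletionMap (L := L) (IsCMField.complexConj L) hw) (Q j i)) = _ from red_coe ⟨_, hσO ⟨Q j i, hQO⟩⟩]
    rw [hredQs] at hredsum
    -- `Nσ̄ᵀ J̄ = −J̄ N`, hence `J̄⁻¹ Nσ̄ᵀ J̄ = −N`
    have hJku : IsUnit (JO.map (IsLocalRing.residue 𝒪[(w.1.adicCompletion L)])).det := isUnit_iff_ne_zero.2 hJkdet
    rw [Matrix.mul_assoc, eq_neg_of_add_eq_zero_left hredsum, Matrix.mul_neg, Matrix.nonsing_inv_mul_cancel_left _ _ hJku]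
  have hθ : (JO.map (IsLocalRing.residue 𝒪[(w.1.adicCompletion L)]))⁻¹ * ((redMat X).map σk)ᵀ * (JO.map (IsLocalRing.residue 𝒪[(w.1.adicCompletion L)])) = -redMat X :=
    hLie hXv hM1 (by rw [hMdef]; exact (xk : ↥(unitaryGroupOfForm (galAdicCompletionMap (L := L) (IsCMField.complexConj L) hw) (placeForm H' w.1))).2)
  have hθ' : (JO.map (IsLocalRing.residue 𝒪[(w.1.adicCompletion L)]))⁻¹ * ((redMat X').map σk)ᵀ * (JO.map (IsLocalRing.residue 𝒪[(w.1.adicCompletion L)])) = -redMat X' :=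
    hLie hX'v hM'1 (by rw [hM'def]; exact (xk' : ↥(unitaryGroupOfForm (galAdicCompletionMap (L := L) (IsCMField.complexConj L) hw) (placeForm H' w.1))).2)
  -- §6 the finite-group conjugator (★ `FiniteUnitaryThreeNilpotentOrbits`) and its Hensel lift `y ∈ K`
  obtain ⟨yb, hyb, hconjN⟩ := exists_unitary_conj_eq_of_pow_three_eq_zero_of_rank_eq hq' σk hσq h2k hJk hJkdet hθ hθ' hnil hnil' hrank
  obtain ⟨xy, hxy⟩ := hsurj ⟨yb, hyb⟩
  obtain ⟨y, hydef⟩ : ∃ y : ((cmDatum L 3 H').Local v), y = (localNonsplitEquiv (IsCMField.complexConj L) H' (IsCMField.complexConj_ne_one L) w hw).symm (xy : ↥(unitaryGroupOfForm (galAdicCompletionMap (L := L) (IsCMField.complexConj L) hw) (placeForm H' w.1))) := ⟨_, rfl⟩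
  have hey : (localNonsplitEquiv (IsCMField.complexConj L) H' (IsCMField.complexConj_ne_one L) w hw y) = (xy : ↥(unitaryGroupOfForm (galAdicCompletionMap (L := L) (IsCMField.complexConj L) hw) (placeForm H' w.1))) := by
    rw [hydef]
    exact (localNonsplitEquiv (IsCMField.complexConj L) H' (IsCMField.complexConj_ne_one L) w hw).apply_symm_apply _
  have hy : y ∈ (cmLocalIntegralLevel L 3 H' v) := by
    refine (mem_localIntegralLevel_iff_of_smul_eq (IsCMField.complexConj L) 3 H' hc1 w hw y).2 ?_
    rw [hey]
    exact xy.2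
  have hyxy : y * x * y⁻¹ ∈ (cmLocalIntegralLevel L 3 H' v) := Subgroup.mul_mem _ (Subgroup.mul_mem _ hy hx) (Subgroup.inv_mem _ hy)
  -- the matrices `Y = (e y)_w`, `Y⁻¹` and their reductions `ȳ`, `ȳ⁻¹`
  obtain ⟨Ym, hYmdef⟩ : ∃ Ym : Matrix (Fin 3) (Fin 3) (w.1.adicCompletion L), Ym = ((((xy : ↥((glInt 3 (w.1.adicCompletion L)).subgroupOf (unitaryGroupOfForm (galAdicCompletionMap (L := L) (IsCMField.complexConj L) hw) (placeForm H' w.1)))) : ↥(unitaryGroupOfForm (galAdicCompletionMap (L := L) (IsCMField.complexConj L) hw) (placeForm H' w.1))) : GL (Fin 3) (w.1.adicCompletion L)) : Matrix (Fin 3) (Fin 3) (w.1.adicCompletion L)) := ⟨_, rfl⟩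
  obtain ⟨Yi, hYidef⟩ : ∃ Yi : Matrix (Fin 3) (Fin 3) (w.1.adicCompletion L), Yi = (((((xy : ↥((glInt 3 (w.1.adicCompletion L)).subgroupOf (unitaryGroupOfForm (galAdicCompletionMap (L := L) (IsCMField.complexConj L) hw) (placeForm H' w.1)))) : ↥(unitaryGroupOfForm (galAdicCompletionMap (L := L) (IsCMField.complexConj L) hw) (placeForm H' w.1))) : GL (Fin 3) (w.1.adicCompletion L))⁻¹ : GL (Fin 3) (w.1.adicCompletion L)) : Matrix (Fin 3) (Fin 3) (w.1.adicCompletion L)) := ⟨_, rfl⟩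
  have hYv : ValBound 1 Ym := by rw [hYmdef]; exact (hglv xy).1
  have hYiv : ValBound 1 Yi := by rw [hYidef]; exact (hglv xy).2
  have hYYi : Ym * Yi = 1 := by rw [hYmdef, hYidef, ← Units.val_mul, mul_inv_cancel, Units.val_one]
  have hredY : redMat Ym = ((yb : GL (Fin 3) 𝓀[(w.1.adicCompletion L)]) : Matrix (Fin 3) (Fin 3) 𝓀[(w.1.adicCompletion L)]) := by
    rw [hYmdef, ← hredK xy, hxy]
  have hredYi : redMat Yi = (((yb⁻¹ : GL (Fin 3) 𝓀[(w.1.adicCompletion L)])) : Matrix (Fin 3) (Fin 3) 𝓀[(w.1.adicCompletion L)]) := by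
    have h := hredK xy⁻¹
    rw [map_inv, hxy] at h
    simp only [Subgroup.coe_inv] at h
    rw [hYidef, ← h]
  -- §7 `X₂ := ϖ⁻¹((e (y x y⁻¹))_w − 1) = Y X Y⁻¹` reduces to `ȳ N ȳ⁻¹ = N′ = red X′`
  have heconj : ((((localNonsplitEquiv (IsCMField.complexConj L) H' (IsCMField.complexConj_ne_one L) w hw (y * x * y⁻¹)) : ↥(unitaryGroupOfForm (galAdicCompletionMap (L := L) (IsCMField.complexConj L) hw) (placeForm H' w.1))) : GL (Fin 3) (w.1.adicCompletion L)) : Matrix (Fin 3) (Fin 3) (w.1.adicCompletion L)) = Ym * M * Yi := by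
    rw [coe_coe_localNonsplitEquiv_conj' L 3 H' hc1 w hw y x, hey, hMe, hYmdef, hYidef]
  have hX2 : ϖ⁻¹ • (Ym * M * Yi - 1) = Ym * X * Yi := by
    rw [hXdef, Matrix.mul_smul, Matrix.smul_mul, Matrix.mul_sub, Matrix.sub_mul, Matrix.mul_one, hYYi]
  have hconj1 : Ym * M * Yi = 1 + ϖ • (Ym * X * Yi) := by rw [← hX2, smul_inv_smul₀ hϖ0, add_sub_cancel]
  have hYXYv : ValBound 1 (Ym * X * Yi) := vmul (vmul hYv hXv) hYiv
  have hredconj : redMat (Ym * X * Yi) = redMat X' := by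
    rw [redMat_mul (vmul hYv hXv) hYiv, redMat_mul hYv hXv, hredY, hredYi, hconjN]
  -- §8 `x′ ≡ y x y⁻¹ (mod ϖ²)`: `D = X′ − Y X Y⁻¹` has `red D = 0`, so `(e x′)_w − (e (yxy⁻¹))_w = ϖD ∈ ϖ²M₃(𝒪_w)`
  have hDv : ValBound 1 (X' - Ym * X * Yi) := hX'v.sub hYXYv
  have hredD : redMat (X' - Ym * X * Yi) = 0 := by rw [redMat_sub hX'v hYXYv, hredconj, sub_self]
  have hDle : ∀ i j, Valued.v ((X' - Ym * X * Yi) i j) ≤ Valued.v ϖ := fun i j =>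
    (v_le_iff_valuation_le _ _).2 (hlt _ ((redMat_eq_zero_iff_forall_valuation_lt_one hDv).1 hredD i j))
  have hcong : IsIntMatrix ((ϖ ^ 2)⁻¹ • (M' - Ym * M * Yi)) := by
    have hdiff : M' - Ym * M * Yi = ϖ • (X' - Ym * X * Yi) := by rw [hM'1, hconj1, smul_sub]; abel
    rw [hdiff, smul_smul, pow_two, mul_inv, mul_assoc, inv_mul_cancel₀ hϖ0, mul_one]
    exact (isIntMatrix_inv_smul_iff hϖ0 _).2 hDle
  have h : IsIntMatrix ((ϖ ^ 2)⁻¹ • (((((localNonsplitEquiv (IsCMField.complexConj L) H' (IsCMField.complexConj_ne_one L) w hw x') : ↥(unitaryGroupOfForm (galAdicCompletionMap (L := L) (IsCMField.complexConj L) hw) (placeForm H' w.1))) : GL (Fin 3) (w.1.adicCompletion L)) : Matrix (Fin 3) (Fin 3) (w.1.adicCompletion L)) -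
      ((((localNonsplitEquiv (IsCMField.complexConj L) H' (IsCMField.complexConj_ne_one L) w hw (y * x * y⁻¹)) : ↥(unitaryGroupOfForm (galAdicCompletionMap (L := L) (IsCMField.complexConj L) hw) (placeForm H' w.1))) : GL (Fin 3) (w.1.adicCompletion L)) : Matrix (Fin 3) (Fin 3) (w.1.adicCompletion L)))) := by
    rw [heconj, hMe']
    exact hcong
  -- §9 assemble: `g x = g (y x y⁻¹) = g x′` (`Ad K`-invariance, then ★ `apply_eq_of_congr_levelTwo` with `hg2`)
  have hψ2 : ∀ U : ((cmDatum L 3 H').Local v), IsIntMatrix ((ϖ ^ 2)⁻¹ • ((((localNonsplitEquiv (IsCMField.complexConj L) H' (IsCMField.complexConj_ne_one L) w hw U :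
      ↥(unitaryGroupOfForm (galAdicCompletionMap (L := L) (IsCMField.complexConj L) hw) (placeForm H' w.1))) : GL (Fin 3) (w.1.adicCompletion L)) :
        Matrix (Fin 3) (Fin 3) (w.1.adicCompletion L)) - 1)) → ∀ z, g (U * z) = g z := fun U hU => hg2 U hU
  have hfin := apply_eq_of_congr_levelTwo L 3 H' (IsCMField.complexConj_ne_one L) w hw g hψ2 x' (y * x * y⁻¹) hyxy h
  exact (hginv y hy x).symm.trans hfin.symm

set_option maxHeartbeats 800000 in
-- budget only: the statement carries the END stub's CM-place tokens; no search tactic runs long here.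
/-- **ORGAN (V)-INT «INTERIOR STRATA CONSTANCY OF A LEVEL-2 `K`-CLASS PIECE»**, general-rank form: a piece `g` on `U(H′)(L⁺_v)` that is `Ad K`-invariant and left-invariant
under the level-2 congruence set takes ONE value `c′ s` on each interior level-2 stratum `{x ∈ K : x_w ≡ 1 (ϖ), (red(ϖ⁻¹(x_w − 1)))³ = 0, rank red(ϖ⁻¹(x_w − 1)) = s}`.
[cite: Rogawski1990, §4.9 p. 54; §3.9 p. 32, Prop. 3.9.1] [cite: PlatonovRapinchuk1994, §3.3] -/
theorem interiorStrataConstancy_of_levelTwo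
    (L : Type) [Field L] [NumberField L] [IsCMField L] (H' : Matrix (Fin 3) (Fin 3) L)
    {v : HeightOneSpectrum (𝓞 ↥(maximalRealSubfield L))}
    (hH' : (H'.map (cmConjRingHom L)).transpose = H') (w : PlacesOver L v)
    (hw : IsCMField.complexConj L • w.1 = w.1) (hv : Algebra.IsUnramifiedIn (𝓞 L) v.asIdeal)
    (hH'w : IsUnit (placeForm H' w.1)) (hH'i : hH'w.unit ∈ glInt 3 (w.1.adicCompletion L))
    (h2 : IsUnit (2 : 𝒪[(w.1.adicCompletion L)]))
    (g : ((cmDatum L 3 H').Local v) → ℂ)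
    (hginv : ∀ u ∈ (cmLocalIntegralLevel L 3 H' v), ∀ x, g (u * x * u⁻¹) = g x)
    (hg2 : ∀ u : ((cmDatum L 3 H').Local v),
      (∀ a b, Valued.v (((toPlace v w (HeckeCharacter.uniformizer ↥(maximalRealSubfield L) v : v.adicCompletion ↥(maximalRealSubfield L))) ^ 2)⁻¹ *
        ((((localNonsplitEquiv (IsCMField.complexConj L) H' (IsCMField.complexConj_ne_one L) w hw u :
            ↥(unitaryGroupOfForm (galAdicCompletionMap (L := L) (IsCMField.complexConj L) hw) (placeForm H' w.1))) : GL (Fin 3) (w.1.adicCompletion L)) :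
              Matrix (Fin 3) (Fin 3) (w.1.adicCompletion L)) a b - (1 : Matrix (Fin 3) (Fin 3) (w.1.adicCompletion L)) a b)) ≤ 1) →
      ∀ x, g (u * x) = g x) :
    ∃ c' : ℕ → ℂ, ∀ x : ((cmDatum L 3 H').Local v), x ∈ (cmLocalIntegralLevel L 3 H' v) →
      (∀ a b, Valued.v (((toPlace v w (HeckeCharacter.uniformizer ↥(maximalRealSubfield L) v : v.adicCompletion ↥(maximalRealSubfield L))) ^ 1)⁻¹ *
        ((((localNonsplitEquiv (IsCMField.complexConj L) H' (IsCMField.complexConj_ne_one L) w hw (x) :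
            ↥(unitaryGroupOfForm (galAdicCompletionMap (L := L) (IsCMField.complexConj L) hw) (placeForm H' w.1))) : GL (Fin 3) (w.1.adicCompletion L)) :
              Matrix (Fin 3) (Fin 3) (w.1.adicCompletion L)) a b - (1 : Matrix (Fin 3) (Fin 3) (w.1.adicCompletion L)) a b)) ≤ 1) →
      (redMat ((toPlace v w (HeckeCharacter.uniformizer ↥(maximalRealSubfield L) v : v.adicCompletion ↥(maximalRealSubfield L)))⁻¹ • ((((x).val : GL (Fin 3) (UnitaryGroup.LocalRing L v)).val.map (Pi.evalRingHom (fun w' : PlacesOver L v => w'.1.adicCompletion L) w)) - 1))) ^ 3 = 0 →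
      g x = c' ((redMat ((toPlace v w (HeckeCharacter.uniformizer ↥(maximalRealSubfield L) v : v.adicCompletion ↥(maximalRealSubfield L)))⁻¹ • ((((x).val : GL (Fin 3) (UnitaryGroup.LocalRing L v)).val.map (Pi.evalRingHom (fun w' : PlacesOver L v => w'.1.adicCompletion L) w)) - 1))).rank) := by
  classical
  refine ⟨fun r => if h : ∃ x : ((cmDatum L 3 H').Local v), x ∈ (cmLocalIntegralLevel L 3 H' v) ∧
      (∀ a b, Valued.v (((toPlace v w (HeckeCharacter.uniformizer ↥(maximalRealSubfield L) v : v.adicCompletion ↥(maximalRealSubfield L))) ^ 1)⁻¹ *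
        ((((localNonsplitEquiv (IsCMField.complexConj L) H' (IsCMField.complexConj_ne_one L) w hw (x) :
            ↥(unitaryGroupOfForm (galAdicCompletionMap (L := L) (IsCMField.complexConj L) hw) (placeForm H' w.1))) : GL (Fin 3) (w.1.adicCompletion L)) :
              Matrix (Fin 3) (Fin 3) (w.1.adicCompletion L)) a b - (1 : Matrix (Fin 3) (Fin 3) (w.1.adicCompletion L)) a b)) ≤ 1) ∧
      (redMat ((toPlace v w (HeckeCharacter.uniformizer ↥(maximalRealSubfield L) v : v.adicCompletion ↥(maximalRealSubfield L)))⁻¹ • ((((x).val : GL (Fin 3) (UnitaryGroup.LocalRing L v)).val.map (Pi.evalRingHom (fun w' : PlacesOver L v => w'.1.adicCompletion L) w)) - 1))) ^ 3 = 0 ∧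
      (redMat ((toPlace v w (HeckeCharacter.uniformizer ↥(maximalRealSubfield L) v : v.adicCompletion ↥(maximalRealSubfield L)))⁻¹ • ((((x).val : GL (Fin 3) (UnitaryGroup.LocalRing L v)).val.map (Pi.evalRingHom (fun w' : PlacesOver L v => w'.1.adicCompletion L) w)) - 1))).rank = r
    then g h.choose else 0, fun x hx hx1 hnil => ?_⟩
  have hex : ∃ x₀ : ((cmDatum L 3 H').Local v), x₀ ∈ (cmLocalIntegralLevel L 3 H' v) ∧
      (∀ a b, Valued.v (((toPlace v w (HeckeCharacter.uniformizer ↥(maximalRealSubfield L) v : v.adicCompletion ↥(maximalRealSubfield L))) ^ 1)⁻¹ *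
        ((((localNonsplitEquiv (IsCMField.complexConj L) H' (IsCMField.complexConj_ne_one L) w hw (x₀) :
            ↥(unitaryGroupOfForm (galAdicCompletionMap (L := L) (IsCMField.complexConj L) hw) (placeForm H' w.1))) : GL (Fin 3) (w.1.adicCompletion L)) :
              Matrix (Fin 3) (Fin 3) (w.1.adicCompletion L)) a b - (1 : Matrix (Fin 3) (Fin 3) (w.1.adicCompletion L)) a b)) ≤ 1) ∧
      (redMat ((toPlace v w (HeckeCharacter.uniformizer ↥(maximalRealSubfield L) v : v.adicCompletion ↥(maximalRealSubfield L)))⁻¹ • ((((x₀).val : GL (Fin 3) (UnitaryGroup.LocalRing L v)).val.map (Pi.evalRingHom (fun w' : PlacesOver L v => w'.1.adicCompletion L) w)) - 1))) ^ 3 = 0 ∧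
      (redMat ((toPlace v w (HeckeCharacter.uniformizer ↥(maximalRealSubfield L) v : v.adicCompletion ↥(maximalRealSubfield L)))⁻¹ • ((((x₀).val : GL (Fin 3) (UnitaryGroup.LocalRing L v)).val.map (Pi.evalRingHom (fun w' : PlacesOver L v => w'.1.adicCompletion L) w)) - 1))).rank =
      (redMat ((toPlace v w (HeckeCharacter.uniformizer ↥(maximalRealSubfield L) v : v.adicCompletion ↥(maximalRealSubfield L)))⁻¹ • ((((x).val : GL (Fin 3) (UnitaryGroup.LocalRing L v)).val.map (Pi.evalRingHom (fun w' : PlacesOver L v => w'.1.adicCompletion L) w)) - 1))).rank := ⟨x, hx, hx1, hnil, rfl⟩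
  dsimp only
  rw [dif_pos hex]
  exact apply_eq_apply_of_rank_redMat_levelTwo_eq L H' hH' w hw hv hH'w hH'i h2 g hginv hg2 hx hex.choose_spec.1 hx1 hex.choose_spec.2.1 hnil
    hex.choose_spec.2.2.1 hex.choose_spec.2.2.2.symm

set_option maxHeartbeats 800000 in
-- budget only: the statement carries the END stub's CM-place tokens; no search tactic runs long here.
/-- **ORGAN (V)-INT in the END's shape** (fold v3.2 `stub_liftValues` :347, the three `INT_s` conjuncts VERBATIM, `s = 0, 1, 2`): `∃ c′`, `g = c′ s` on
`INT_s = {x ∈ K : x_w ≡ 1 (ϖ), (red(ϖ⁻¹(x_w − 1)))³ = 0, rank = s}`. [cite: Rogawski1990, §4.9 p. 54; §3.9 p. 32, Prop. 3.9.1] [cite: PlatonovRapinchuk1994, §3.3] -/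
theorem interiorStrataConstancy_of_levelTwo_int
    (L : Type) [Field L] [NumberField L] [IsCMField L] (H' : Matrix (Fin 3) (Fin 3) L)
    {v : HeightOneSpectrum (𝓞 ↥(maximalRealSubfield L))}
    (hH' : (H'.map (cmConjRingHom L)).transpose = H') (w : PlacesOver L v)
    (hw : IsCMField.complexConj L • w.1 = w.1) (hv : Algebra.IsUnramifiedIn (𝓞 L) v.asIdeal)
    (hH'w : IsUnit (placeForm H' w.1)) (hH'i : hH'w.unit ∈ glInt 3 (w.1.adicCompletion L))
    (h2 : IsUnit (2 : 𝒪[(w.1.adicCompletion L)]))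
    (g : ((cmDatum L 3 H').Local v) → ℂ)
    (hginv : ∀ u ∈ (cmLocalIntegralLevel L 3 H' v), ∀ x, g (u * x * u⁻¹) = g x)
    (hg2 : ∀ u : ((cmDatum L 3 H').Local v),
      (∀ a b, Valued.v (((toPlace v w (HeckeCharacter.uniformizer ↥(maximalRealSubfield L) v : v.adicCompletion ↥(maximalRealSubfield L))) ^ 2)⁻¹ *
        ((((localNonsplitEquiv (IsCMField.complexConj L) H' (IsCMField.complexConj_ne_one L) w hw u :
            ↥(unitaryGroupOfForm (galAdicCompletionMap (L := L) (IsCMField.complexConj L) hw) (placeForm H' w.1))) : GL (Fin 3) (w.1.adicCompletion L)) :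
              Matrix (Fin 3) (Fin 3) (w.1.adicCompletion L)) a b - (1 : Matrix (Fin 3) (Fin 3) (w.1.adicCompletion L)) a b)) ≤ 1) →
      ∀ x, g (u * x) = g x) :
    ∃ c' : ℕ → ℂ,
      ((∀ x : ((cmDatum L 3 H').Local v), (x ∈ cmLocalIntegralLevel L 3 H' v ∧ (∀ a b, Valued.v (((toPlace v w (HeckeCharacter.uniformizer ↥(maximalRealSubfield L) v : v.adicCompletion ↥(maximalRealSubfield L))) ^ 1)⁻¹ *
        ((((localNonsplitEquiv (IsCMField.complexConj L) H' (IsCMField.complexConj_ne_one L) w hw (x) :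
            ↥(unitaryGroupOfForm (galAdicCompletionMap (L := L) (IsCMField.complexConj L) hw) (placeForm H' w.1))) : GL (Fin 3) (w.1.adicCompletion L)) :
              Matrix (Fin 3) (Fin 3) (w.1.adicCompletion L)) a b - (1 : Matrix (Fin 3) (Fin 3) (w.1.adicCompletion L)) a b)) ≤ 1) ∧
        (redMat ((toPlace v w (HeckeCharacter.uniformizer ↥(maximalRealSubfield L) v : v.adicCompletion ↥(maximalRealSubfield L)))⁻¹ • ((((x).val : GL (Fin 3) (UnitaryGroup.LocalRing L v)).val.map (Pi.evalRingHom (fun w' : PlacesOver L v => w'.1.adicCompletion L) w)) - 1))) ^ 3 = 0 ∧ (redMat ((toPlace v w (HeckeCharacter.uniformizer ↥(maximalRealSubfield L) v : v.adicCompletion ↥(maximalRealSubfield L)))⁻¹ • ((((x).val : GL (Fin 3) (UnitaryGroup.LocalRing L v)).val.map (Pi.evalRingHom (fun w' : PlacesOver L v => w'.1.adicCompletion L) w)) - 1))).rank = 0) → g x = c' 0) ∧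
      (∀ x : ((cmDatum L 3 H').Local v), (x ∈ cmLocalIntegralLevel L 3 H' v ∧ (∀ a b, Valued.v (((toPlace v w (HeckeCharacter.uniformizer ↥(maximalRealSubfield L) v : v.adicCompletion ↥(maximalRealSubfield L))) ^ 1)⁻¹ *
        ((((localNonsplitEquiv (IsCMField.complexConj L) H' (IsCMField.complexConj_ne_one L) w hw (x) :
            ↥(unitaryGroupOfForm (galAdicCompletionMap (L := L) (IsCMField.complexConj L) hw) (placeForm H' w.1))) : GL (Fin 3) (w.1.adicCompletion L)) :
              Matrix (Fin 3) (Fin 3) (w.1.adicCompletion L)) a b - (1 : Matrix (Fin 3) (Fin 3) (w.1.adicCompletion L)) a b)) ≤ 1) ∧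
        (redMat ((toPlace v w (HeckeCharacter.uniformizer ↥(maximalRealSubfield L) v : v.adicCompletion ↥(maximalRealSubfield L)))⁻¹ • ((((x).val : GL (Fin 3) (UnitaryGroup.LocalRing L v)).val.map (Pi.evalRingHom (fun w' : PlacesOver L v => w'.1.adicCompletion L) w)) - 1))) ^ 3 = 0 ∧ (redMat ((toPlace v w (HeckeCharacter.uniformizer ↥(maximalRealSubfield L) v : v.adicCompletion ↥(maximalRealSubfield L)))⁻¹ • ((((x).val : GL (Fin 3) (UnitaryGroup.LocalRing L v)).val.map (Pi.evalRingHom (fun w' : PlacesOver L v => w'.1.adicCompletion L) w)) - 1))).rank = 1) → g x = c' 1) ∧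
      (∀ x : ((cmDatum L 3 H').Local v), (x ∈ cmLocalIntegralLevel L 3 H' v ∧ (∀ a b, Valued.v (((toPlace v w (HeckeCharacter.uniformizer ↥(maximalRealSubfield L) v : v.adicCompletion ↥(maximalRealSubfield L))) ^ 1)⁻¹ *
        ((((localNonsplitEquiv (IsCMField.complexConj L) H' (IsCMField.complexConj_ne_one L) w hw (x) :
            ↥(unitaryGroupOfForm (galAdicCompletionMap (L := L) (IsCMField.complexConj L) hw) (placeForm H' w.1))) : GL (Fin 3) (w.1.adicCompletion L)) :
              Matrix (Fin 3) (Fin 3) (w.1.adicCompletion L)) a b - (1 : Matrix (Fin 3) (Fin 3) (w.1.adicCompletion L)) a b)) ≤ 1) ∧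
        (redMat ((toPlace v w (HeckeCharacter.uniformizer ↥(maximalRealSubfield L) v : v.adicCompletion ↥(maximalRealSubfield L)))⁻¹ • ((((x).val : GL (Fin 3) (UnitaryGroup.LocalRing L v)).val.map (Pi.evalRingHom (fun w' : PlacesOver L v => w'.1.adicCompletion L) w)) - 1))) ^ 3 = 0 ∧ (redMat ((toPlace v w (HeckeCharacter.uniformizer ↥(maximalRealSubfield L) v : v.adicCompletion ↥(maximalRealSubfield L)))⁻¹ • ((((x).val : GL (Fin 3) (UnitaryGroup.LocalRing L v)).val.map (Pi.evalRingHom (fun w' : PlacesOver L v => w'.1.adicCompletion L) w)) - 1))).rank = 2) → g x = c' 2)) := by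
  obtain ⟨c', hc'⟩ := interiorStrataConstancy_of_levelTwo L H' hH' w hw hv hH'w hH'i h2 g hginv hg2
  exact ⟨c', fun x hx => (hc' x hx.1 hx.2.1 hx.2.2.1).trans (by rw [hx.2.2.2]), fun x hx => (hc' x hx.1 hx.2.1 hx.2.2.1).trans (by rw [hx.2.2.2]),
    fun x hx => (hc' x hx.1 hx.2.1 hx.2.2.1).trans (by rw [hx.2.2.2])⟩

end OrganVInt

end Literature.NumberTheory.Rogawski1990

end
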